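import Literature.Barriers.FinalStateConjecture.NonSmoothNullInfinityScattering
import Literature.Barriers.FinalStateConjecture.NonSmoothNullInfinityProofs
import Mathlib.Analysis.Calculus.FDeriv.Symmetric
import Mathlib.Analysis.Calculus.IteratedDeriv.Lemmas
import Mathlib.Analysis.SpecialFunctions.Log.Deriv
import Mathlib.Analysis.SpecialFunctions.Pow.Asymptotics
import HarnessLib

/-!
# Barrier catalogue `FinalStateConjecture`: the linear scattering problem on Schwarzschild —
# calculus toolkit and representation formulas for scattering solutions
(`Literature/Barriers/FinalStateConjecture/`, D-0021, D-0014; family `gr`; namespace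
`Literature.Barriers.FinalStateConjecture`; first instalment of the discharge of
`SchwarzschildLinearScattering_uDecay`, Kehrberger's estimate (6.17))

`NonSmoothNullInfinityScattering.lean` vendors the `|u|`-decay estimate (6.17) of Kehrberger's
Thm. 6.2 (arXiv:2105.08079v3) as the named fact `SchwarzschildLinearScattering_uDecay`: for the
scattering solution `ψ = rφ` of `∂ᵤ∂ᵥψ = −2M(1 − 2M/r)ψ/r³` with compactly supported data `G` on `𝓘⁻`
whose moments `I⁽ᵏ⁾[G]`, `k < n`, vanish,
`|ψ(u,v) + I⁽ⁿ⁾[G](n+1)!/|u|^{2+n}| ≤ C log|u|/|u|^{3+n}` for `u < U₀`, `v ≥ v₂`. The printed proof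
(Thm. 6.1 for `n = 0`: integrate `∂ᵥ(r³∂ᵤ(rφ))` over the data region and then `∂ᵤ(rφ)` from `𝓘⁻`
along `v = v₂`; Thm. 6.2: induction on `n` through the time integral `rφ = (∂ᵤ + ∂ᵥ)(rφ^T)`, the
induction hypothesis carrying all `∂ᵤ^m`-derivatives) is elementary but long; it is discharged
across the sibling files `…ScatteringCalculus` (this file), `…ScatteringTimeIntegral`,
`…ScatteringTower` and `…ScatteringProofs`. This file provides the calculus the later files run on:

* comparison principles turning derivative bounds into increment bounds, on a convex set and
  towards `u → −∞` (`abs_sub_le_sub_of_abs_deriv_le`, `abs_sub_lim_le_of_abs_deriv_le`) — all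
  "integrations from `𝓘⁻`" below are done this way, with explicit primitives, so that no improper
  integral is ever formed;
* symmetry of mixed partials and the iterated derivative `∂ᵤ^m` (`iterPartialU`) of jointly
  smooth functions of `(u, v)`, with the Leibniz rule (`iterPartialU_mul`) and `∂ᵥ∂ᵤ^m = ∂ᵤ^m∂ᵥ`;
* calculus of inverse powers of the EF area radius: `∂ᵤ(1/r^k) = k(1 − 2M/r)/r^{k+1}`,
  `∂ᵥ(1/r^k) = −k(1 − 2M/r)/r^{k+1}`, and the resulting integration rules against `A/r^{k+1}` on the
  region `r ≥ 4M` (where `1 − 2M/r ≥ 1/2`): `IsEFAreaRadius.abs_sub_lim_le_inv_pow` (in `u`, from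
  `𝓘⁻`) and `IsEFAreaRadius.abs_sub_le_inv_pow_snd` (in `v`);
* the tortoise identity `r + 2M log(r − 2M) = v − u + c` (`IsEFAreaRadius.exists_tortoise_const`,
  Kehrberger §3.2) and its consequence along `v = v₂`: `|r(u,v₂) − |u|| ≤ K log|u|`,
  `|u|/2 ≤ r ≤ 2|u|`, `|1/r^k − 1/|u|^k| ≤ C log|u|/|u|^{k+1}` for `u ≤ U ≤ −e`
  (`abs_sub_abs_le_log`, `abs_inv_pow_sub_inv_pow_le`) — the origin of the `log|u|` in (6.17)
  (§6.2, footnote 55: in the EF gauge "the `O(|u|⁻³)`-term in (6.3) is replaced by an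
  `O(|u|⁻³ log|u|)`-term");
* smoothness of the slices `u ↦ r(u,v)`, `v ↦ r(u,v)` (bootstrap from `∂r = ∓(1 − 2M/r)`) and of
  the `u`-slices of the potential `V = −2M(1 − 2M/r)/r³` (`IsEFAreaRadius.contDiff_fst`,
  `contDiff_snd`, `contDiff_efPotential_fst`) — the hypothesis `IsEFAreaRadius` only records the
  two partial derivatives, and everything below is arranged to use slices only;
* the weight bound `efWeight M r x u ≤ 4M/r(u,x)²` on `r ≥ 4M` (`efWeight_le_of_le`);
* representation formulas for a scattering solution `ψ` (`IsScatteringSolution M r v₁ G ψ`):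
  `∂ᵤψ(u,v) = ∫_{v₁}^{v} Vψ(u,x) dx` (`IsScatteringSolution.partialU_eq_integral`), the bounds
  `|∂ᵤψ| ≤ (x − v₁)(2M/r(u,v₁)³) m` and `|ψ(u,x) − G(x)| ≤ (x − v₁) m P(u)` from a bound `|ψ| ≤ m`
  (`abs_partialU_le`, `abs_sub_data_le`), the convergence `∂ᵥψ(u,x) → G'(x)` at `𝓘⁻` with the
  differentiability of the data and `G(x) = ∫_{v₁}^{x} lim ∂ᵥψ` (`tendsto_partialV_deriv`,
  "`∂ᵥ(rφ^T)(−∞, v) = (G^T)'(v)`", proof of Thm. 6.2), and the quantitative form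
  `|∂ᵥψ(u,x) − G'(x)| ≤ m · efWeight M r x u` (`abs_partialV_sub_deriv_le`), i.e.
  "`∂ᵥ(rφ)(u,v) = G'(v) + ∫_{−∞}^{u} Vrφ du'`" with the integral estimated, which is how the wave
  equation is "integrated from `𝓘⁻`" throughout §4 and §6 of the source.

* derivatives along the time-translation orbits `s ↦ (u + s, v + s)` (`hasDerivAt_diag`,
  `hasDerivAt_diag_zero`: the derivative is `(∂ᵤ + ∂ᵥ)φ`), the invariance `r(u + s, v + s) = r(u, v)`,
  `V(u − v + y, y) = V(u, v)` (`IsEFAreaRadius.diag_invariant`, `efPotential_diag`; from the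
  tortoise identity and strict monotonicity of `ρ ↦ ρ + 2M log(ρ − 2M)`), and the definition of
  **the time integral** `timeIntegral v₁ ψ (u, v) := ∫_{v₁}^{v} ψ(u − v + y, y) dy` of a function of
  the double null coordinates — for a scattering solution `rφ` with data `G` this is Kehrberger's
  `rφ^T`, the solution with data `G^T = ∫_{v₁}^{·} G` and `(∂ᵤ + ∂ᵥ)(rφ^T) = rφ` (proof of Thm. 6.2,
  eqs. (6.22)–(6.23)), written down explicitly instead of being obtained from an existence theorem;
  its properties are proved in `…ScatteringTimeIntegral.lean`.

Everything here is elementary real analysis on Mathlib; nothing is asserted as a fact. The two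
definitions (`iterPartialU`, `timeIntegral`) are the only new notions of the whole discharge.

## References

* L. M. A. Kehrberger, *The case against smooth null infinity I: heuristics and counter-examples*,
  Ann. Henri Poincaré 23 (2022) 829–921 = arXiv:2105.08079 (v3, 2023): §3.2 (EF gauge, tortoise
  coordinate), §6.1 Thm. 6.1 and its proof, §6.2 eq. (6.14), Thm. 6.2 eq. (6.17) and its proof,
  footnote 55. Key `Kehrberger2022AHP`.
-/

noncomputable section

open Set Filter Topology

namespace Literature.Barriers.FinalStateConjecture

/-! ### Comparison lemmas: bounds on a derivative give bounds on increments -/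

/-- **Comparison principle on a convex set.** If `|f'| ≤ φ'` on the interior of a convex set
`D ⊆ ℝ` (both functions differentiable on `D`), then `|f b − f a| ≤ φ b − φ a` for `a ≤ b` in `D`
(`f − φ` is non-increasing and `f + φ` non-decreasing). [folklore] -/
theorem abs_sub_le_sub_of_abs_deriv_le {D : Set ℝ} (hD : Convex ℝ D) {f f' φ φ' : ℝ → ℝ}
    (hf : ∀ s ∈ D, HasDerivAt f (f' s) s) (hφ : ∀ s ∈ D, HasDerivAt φ (φ' s) s)
    (hle : ∀ s ∈ interior D, |f' s| ≤ φ' s) {a b : ℝ} (ha : a ∈ D) (hb : b ∈ D) (hab : a ≤ b) :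
    |f b - f a| ≤ φ b - φ a := by
  have hanti : AntitoneOn (fun s ↦ f s - φ s) D := by
    refine antitoneOn_of_deriv_nonpos hD
      (fun s hs ↦ ((hf s hs).fun_sub (hφ s hs)).continuousAt.continuousWithinAt)
      (fun s hs ↦ ((hf s (interior_subset hs)).fun_sub
        (hφ s (interior_subset hs))).differentiableAt.differentiableWithinAt) fun s hs ↦ ?_
    rw [((hf s (interior_subset hs)).fun_sub (hφ s (interior_subset hs))).deriv]
    have := (le_abs_self _).trans (hle s hs)
    linarith
  have hmono : MonotoneOn (fun s ↦ f s + φ s) D := by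
    refine monotoneOn_of_deriv_nonneg hD
      (fun s hs ↦ ((hf s hs).fun_add (hφ s hs)).continuousAt.continuousWithinAt)
      (fun s hs ↦ ((hf s (interior_subset hs)).fun_add
        (hφ s (interior_subset hs))).differentiableAt.differentiableWithinAt) fun s hs ↦ ?_
    rw [((hf s (interior_subset hs)).fun_add (hφ s (interior_subset hs))).deriv]
    have := (neg_abs_le _).trans (hle s hs)
    have h' : -f' s ≤ |f' s| := neg_le_abs _
    linarith [hle s hs]
  have h₁ := hanti ha hb hab
  have h₂ := hmono ha hb hab
  simp only at h₁ h₂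
  rw [abs_le]
  constructor <;> linarith

/-- Comparison principle towards `−∞`: if `|f'| ≤ φ'` on `(−∞, U]`, `f → L` and `φ → Φ` as
`s → −∞`, then `|f u − L| ≤ φ u − Φ` for `u ≤ U`. [folklore] -/
theorem abs_sub_lim_le_of_abs_deriv_le {U : ℝ} {f f' φ φ' : ℝ → ℝ}
    (hf : ∀ s ≤ U, HasDerivAt f (f' s) s) (hφ : ∀ s ≤ U, HasDerivAt φ (φ' s) s)
    (hle : ∀ s < U, |f' s| ≤ φ' s) {L Φ : ℝ} (hfl : Tendsto f atBot (𝓝 L))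
    (hφl : Tendsto φ atBot (𝓝 Φ)) {u : ℝ} (hu : u ≤ U) : |f u - L| ≤ φ u - Φ := by
  have key : ∀ a ≤ u, |f u - f a| ≤ φ u - φ a := fun a ha ↦
    abs_sub_le_sub_of_abs_deriv_le (convex_Iic U) (fun s hs ↦ hf s hs) (fun s hs ↦ hφ s hs)
      (fun s hs ↦ hle s (by simpa [interior_Iic] using hs)) (ha.trans hu) hu ha
  have h1 : Tendsto (fun a ↦ |f u - f a|) atBot (𝓝 |f u - L|) :=
    (tendsto_const_nhds.sub hfl).abs
  have h2 : Tendsto (fun a ↦ φ u - φ a) atBot (𝓝 (φ u - Φ)) := tendsto_const_nhds.sub hφl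
  exact le_of_tendsto_of_tendsto h1 h2 ((eventually_le_atBot u).mono key)

/-- Comparison principle with a constant bound on an interval: if `|f'| ≤ C` on `[a, b]` then
`|f b − f a| ≤ C (b − a)`. [folklore] -/
theorem abs_sub_le_mul_of_abs_deriv_le {f f' : ℝ → ℝ} {a b C : ℝ} (hab : a ≤ b)
    (hf : ∀ s ∈ Icc a b, HasDerivAt f (f' s) s) (hle : ∀ s ∈ Ioo a b, |f' s| ≤ C) :
    |f b - f a| ≤ C * (b - a) := by
  have h := abs_sub_le_sub_of_abs_deriv_le (convex_Icc a b) hf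
    (φ := fun s ↦ C * s) (φ' := fun _ ↦ C) (fun s _ ↦ by
      simpa using (hasDerivAt_id s).const_mul C)
    (fun s hs ↦ hle s (by simpa [interior_Icc] using hs)) (left_mem_Icc.2 hab)
    (right_mem_Icc.2 hab) hab
  simpa [mul_sub] using h

/-! ### Mixed partial derivatives of smooth functions of two variables commute -/

section Smooth

variable {ψ : ℝ → ℝ → ℝ}

/-- For jointly smooth `ψ`, `∂ᵥ∂ᵤψ = ∂ᵤ∂ᵥψ` (symmetry of second derivatives). [folklore] -/
theorem partialV_partialU_eq (hψ : ContDiff ℝ ((⊤ : ℕ∞) : WithTop ℕ∞) (Function.uncurry ψ))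
    (u v : ℝ) : partialV (partialU ψ) u v = partialU (partialV ψ) u v := by
  set F := Function.uncurry ψ with hF
  have hF1 : Differentiable ℝ F := hψ.differentiable (by simp)
  have hF2 : ContDiff ℝ ((⊤ : ℕ∞) : WithTop ℕ∞) (fderiv ℝ F) :=
    (contDiff_infty_iff_fderiv.1 hψ).2
  have hsymm : IsSymmSndFDerivAt ℝ F (u, v) :=
    (hψ.contDiffAt (x := (u, v))).isSymmSndFDerivAt (by
      simp only [minSmoothness_of_isRCLikeNormedField]
      have h : ((2 : ℕ∞) : WithTop ℕ∞) ≤ ((⊤ : ℕ∞) : WithTop ℕ∞) := WithTop.coe_le_coe.2 le_top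
      exact h)
  -- `∂ᵥ∂ᵤψ(u,v) = D(p ↦ DF(p)(1,0))(u,v)(0,1) = D²F(u,v)(0,1)(1,0)`
  have hU : Function.uncurry (partialU ψ) = fun p ↦ fderiv ℝ F p (1, 0) := by
    funext p; exact partialU_eq_fderiv hψ p.1 p.2
  have hV : Function.uncurry (partialV ψ) = fun p ↦ fderiv ℝ F p (0, 1) := by
    funext p; exact partialV_eq_fderiv hψ p.1 p.2
  have h1 : partialV (partialU ψ) u v = fderiv ℝ (fderiv ℝ F) (u, v) (0, 1) (1, 0) := by
    rw [partialV_eq_fderiv (contDiff_partialU hψ), hU]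
    rw [fderiv_clm_apply (hF2.differentiable (by simp) (u, v)) (differentiableAt_const _)]
    simp
  have h2 : partialU (partialV ψ) u v = fderiv ℝ (fderiv ℝ F) (u, v) (1, 0) (0, 1) := by
    rw [partialU_eq_fderiv (contDiff_partialV hψ), hV]
    rw [fderiv_clm_apply (hF2.differentiable (by simp) (u, v)) (differentiableAt_const _)]
    simp
  rw [h1, h2]
  exact hsymm.eq (0, 1) (1, 0)

end Smooth

/-! ### Iterated `∂ᵤ`-derivatives -/

/-- The iterated partial derivative `∂ᵤ^m ψ` of a curried function of two variables
(`∂ᵤ^0 ψ = ψ`, `∂ᵤ^{m+1} ψ = ∂ᵤ(∂ᵤ^m ψ)`). [folklore] -/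
def iterPartialU : ℕ → (ℝ → ℝ → ℝ) → ℝ → ℝ → ℝ
  | 0, ψ => ψ
  | m + 1, ψ => partialU (iterPartialU m ψ)

/-- `∂ᵤ^0 ψ = ψ`. [folklore] -/
@[simp] lemma iterPartialU_zero (ψ : ℝ → ℝ → ℝ) : iterPartialU 0 ψ = ψ := rfl

/-- `∂ᵤ^{m+1} ψ = ∂ᵤ(∂ᵤ^m ψ)`. [folklore] -/
lemma iterPartialU_succ (m : ℕ) (ψ : ℝ → ℝ → ℝ) :
    iterPartialU (m + 1) ψ = partialU (iterPartialU m ψ) := rfl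

/-- `∂ᵤ^{m+1} ψ = ∂ᵤ^m (∂ᵤ ψ)`. [folklore] -/
lemma iterPartialU_succ' (m : ℕ) (ψ : ℝ → ℝ → ℝ) :
    iterPartialU (m + 1) ψ = iterPartialU m (partialU ψ) := by
  induction m with
  | zero => rfl
  | succ m ih => rw [iterPartialU_succ, ih, ← iterPartialU_succ]

/-- `∂ᵤ^m ψ (u, v)` is the `m`-th derivative of the slice `u ↦ ψ(u, v)`. [folklore] -/
lemma iterPartialU_eq_iteratedDeriv (m : ℕ) (ψ : ℝ → ℝ → ℝ) (u v : ℝ) :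
    iterPartialU m ψ u v = iteratedDeriv m (fun u' ↦ ψ u' v) u := by
  induction m generalizing u with
  | zero => simp
  | succ m ih =>
    rw [iterPartialU_succ, partialU, iteratedDeriv_succ]
    congr 1
    funext u'
    exact ih u'

/-- `∂ᵤ^m` of a jointly smooth function is jointly smooth. [folklore] -/
lemma contDiff_iterPartialU {ψ : ℝ → ℝ → ℝ}
    (hψ : ContDiff ℝ ((⊤ : ℕ∞) : WithTop ℕ∞) (Function.uncurry ψ)) (m : ℕ) :
    ContDiff ℝ ((⊤ : ℕ∞) : WithTop ℕ∞) (Function.uncurry (iterPartialU m ψ)) := by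
  induction m with
  | zero => simpa using hψ
  | succ m ih => rw [iterPartialU_succ]; exact contDiff_partialU ih

/-- `∂ᵥ` commutes with `∂ᵤ^m` for jointly smooth functions. [folklore] -/
lemma partialV_iterPartialU {ψ : ℝ → ℝ → ℝ}
    (hψ : ContDiff ℝ ((⊤ : ℕ∞) : WithTop ℕ∞) (Function.uncurry ψ)) (m : ℕ) :
    partialV (iterPartialU m ψ) = iterPartialU m (partialV ψ) := by
  induction m with
  | zero => rfl
  | succ m ih =>
    funext u v
    rw [iterPartialU_succ, partialV_partialU_eq (contDiff_iterPartialU hψ m), iterPartialU_succ]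
    simp only [partialU]
    congr 1
    funext u'
    rw [ih]

/-- The slices `u ↦ ψ(u, v)` of a jointly smooth function are smooth. [folklore] -/
lemma contDiff_slice_fst {ψ : ℝ → ℝ → ℝ}
    (hψ : ContDiff ℝ ((⊤ : ℕ∞) : WithTop ℕ∞) (Function.uncurry ψ)) (v : ℝ) :
    ContDiff ℝ ((⊤ : ℕ∞) : WithTop ℕ∞) (fun u ↦ ψ u v) :=
  hψ.comp (contDiff_id.prodMk contDiff_const)

/-- The slices `v ↦ ψ(u, v)` of a jointly smooth function are smooth. [folklore] -/
lemma contDiff_slice_snd {ψ : ℝ → ℝ → ℝ}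
    (hψ : ContDiff ℝ ((⊤ : ℕ∞) : WithTop ℕ∞) (Function.uncurry ψ)) (u : ℝ) :
    ContDiff ℝ ((⊤ : ℕ∞) : WithTop ℕ∞) (fun v ↦ ψ u v) :=
  hψ.comp (contDiff_const.prodMk contDiff_id)

/-- `∂ᵤ^m` is additive (smooth `u`-slices suffice). [folklore] -/
lemma iterPartialU_add {ψ₁ ψ₂ : ℝ → ℝ → ℝ} {v : ℝ}
    (h₁ : ContDiff ℝ ((⊤ : ℕ∞) : WithTop ℕ∞) (fun u ↦ ψ₁ u v))
    (h₂ : ContDiff ℝ ((⊤ : ℕ∞) : WithTop ℕ∞) (fun u ↦ ψ₂ u v)) (m : ℕ) (u : ℝ) :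
    iterPartialU m (fun a b ↦ ψ₁ a b + ψ₂ a b) u v = iterPartialU m ψ₁ u v + iterPartialU m ψ₂ u v := by
  rw [iterPartialU_eq_iteratedDeriv, iterPartialU_eq_iteratedDeriv, iterPartialU_eq_iteratedDeriv]
  exact iteratedDeriv_add (h₁.contDiffAt.of_le (by exact_mod_cast le_top))
    (h₂.contDiffAt.of_le (by exact_mod_cast le_top))

/-- `∂ᵤ^m` commutes with scalars. [folklore] -/
lemma iterPartialU_const_mul {ψ : ℝ → ℝ → ℝ} {v : ℝ}
    (h : ContDiff ℝ ((⊤ : ℕ∞) : WithTop ℕ∞) (fun u ↦ ψ u v)) (c : ℝ) (m : ℕ) (u : ℝ) :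
    iterPartialU m (fun a b ↦ c * ψ a b) u v = c * iterPartialU m ψ u v := by
  rw [iterPartialU_eq_iteratedDeriv, iterPartialU_eq_iteratedDeriv]
  exact iteratedDeriv_const_mul c (h.contDiffAt.of_le (by exact_mod_cast le_top))

/-- **Leibniz rule** for `∂ᵤ^m` of a product (smooth `u`-slices suffice). [folklore] -/
lemma iterPartialU_mul {V ψ : ℝ → ℝ → ℝ} {v : ℝ}
    (hV : ContDiff ℝ ((⊤ : ℕ∞) : WithTop ℕ∞) (fun u ↦ V u v))
    (hψ : ContDiff ℝ ((⊤ : ℕ∞) : WithTop ℕ∞) (fun u ↦ ψ u v)) (m : ℕ) (u : ℝ) :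
    iterPartialU m (fun a b ↦ V a b * ψ a b) u v =
      ∑ i ∈ Finset.range (m + 1),
        (m.choose i : ℝ) * iterPartialU i V u v * iterPartialU (m - i) ψ u v := by
  rw [iterPartialU_eq_iteratedDeriv]
  have hcV : ContDiffAt ℝ m (fun u' ↦ V u' v) u := hV.contDiffAt.of_le (by exact_mod_cast le_top)
  have hcψ : ContDiffAt ℝ m (fun u' ↦ ψ u' v) u := hψ.contDiffAt.of_le (by exact_mod_cast le_top)
  have h := iteratedDeriv_mul hcV hcψ
  have heq : (fun u' ↦ V u' v * ψ u' v) = (fun u' ↦ V u' v) * (fun u' ↦ ψ u' v) := rfl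
  rw [heq, h]
  refine Finset.sum_congr rfl fun i _ ↦ ?_
  rw [iterPartialU_eq_iteratedDeriv, iterPartialU_eq_iteratedDeriv]

/-- The `u`-slices of `∂ᵤ^m ψ` are smooth if those of `ψ` are. [folklore] -/
lemma contDiff_iterPartialU_slice {ψ : ℝ → ℝ → ℝ} {v : ℝ}
    (h : ContDiff ℝ ((⊤ : ℕ∞) : WithTop ℕ∞) (fun u ↦ ψ u v)) (m : ℕ) :
    ContDiff ℝ ((⊤ : ℕ∞) : WithTop ℕ∞) (fun u ↦ iterPartialU m ψ u v) := by
  have : (fun u ↦ iterPartialU m ψ u v) = iteratedDeriv m (fun u' ↦ ψ u' v) :=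
    funext fun u ↦ iterPartialU_eq_iteratedDeriv m ψ u v
  rw [this, iteratedDeriv_eq_iterate]
  exact h.iterate_deriv m

/-! ### Calculus of inverse powers of the area radius -/

namespace IsEFAreaRadius

variable {M : ℝ} {r : ℝ → ℝ → ℝ}

/-- `r(·, v)` is non-increasing (`∂ᵤr = −(1 − 2M/r) < 0`). [folklore] -/
lemma antitone_fst (hr : IsEFAreaRadius M r) (hM : 0 ≤ M) (v : ℝ) : Antitone (fun u ↦ r u v) :=
  antitone_of_deriv_nonpos (fun u ↦ (hr.hasDerivAt_fst u v).differentiableAt) fun u ↦ by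
    rw [(hr.hasDerivAt_fst u v).deriv]
    have := hr.factor_pos hM u v
    linarith

/-- `r(·, v)` is continuous. [folklore] -/
lemma continuous_fst (hr : IsEFAreaRadius M r) (v : ℝ) : Continuous (fun u ↦ r u v) :=
  continuous_iff_continuousAt.2 fun u ↦ (hr.hasDerivAt_fst u v).continuousAt

/-- On `r ≥ 4M` the red-shift factor is at least `1/2`: `1/2 ≤ 1 − 2M/r`. [folklore] -/
lemma half_le_factor (hr : IsEFAreaRadius M r) (hM : 0 ≤ M) {u v : ℝ} (h4 : 4 * M ≤ r u v) :
    1 / 2 ≤ 1 - 2 * M / r u v := by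
  have hr0 := hr.pos hM u v
  have h : 2 * M / r u v ≤ 1 / 2 := by
    rw [div_le_iff₀ hr0]
    linarith
  linarith

/-- Towards `𝓘⁻` the area radius exceeds any bound, uniformly in `v ≥ v₁`: there is `U` with
`R ≤ r(u, v)` for all `u ≤ U`, `v ≥ v₁`. [folklore] -/
lemma exists_forall_le (hr : IsEFAreaRadius M r) (hM : 0 ≤ M) (v₁ R : ℝ) :
    ∃ U : ℝ, ∀ u ≤ U, ∀ v, v₁ ≤ v → R ≤ r u v := by
  obtain ⟨U, hU⟩ := ((hr.tendsto_atBot hM v₁).eventually_ge_atTop R).exists_forall_of_atBot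
  exact ⟨U, fun u hu v hv ↦ (hU u hu).trans (hr.monotone_snd hM u hv)⟩

/-- `∂ᵤ(1/r^k) = k (1 − 2M/r)/r^{k+1}`. [folklore] -/
lemma hasDerivAt_inv_pow_fst (hr : IsEFAreaRadius M r) (hM : 0 ≤ M) (k : ℕ) (u v : ℝ) :
    HasDerivAt (fun u' ↦ 1 / r u' v ^ k) (k * (1 - 2 * M / r u v) / r u v ^ (k + 1)) u := by
  have hr0 : r u v ≠ 0 := (hr.pos hM u v).ne'
  have h := ((hr.hasDerivAt_fst u v).fun_pow k).fun_inv (pow_ne_zero k hr0)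
  simp only [one_div]
  refine h.congr_deriv ?_
  rcases k with _ | k
  · simp
  · rw [Nat.add_sub_cancel]
    field_simp
    ring

/-- `∂ᵥ(1/r^k) = −k (1 − 2M/r)/r^{k+1}`. [folklore] -/
lemma hasDerivAt_inv_pow_snd (hr : IsEFAreaRadius M r) (hM : 0 ≤ M) (k : ℕ) (u v : ℝ) :
    HasDerivAt (fun v' ↦ 1 / r u v' ^ k) (-(k * (1 - 2 * M / r u v) / r u v ^ (k + 1))) v := by
  have hr0 : r u v ≠ 0 := (hr.pos hM u v).ne'
  have h := ((hr.hasDerivAt_snd u v).fun_pow k).fun_inv (pow_ne_zero k hr0)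
  simp only [one_div]
  refine h.congr_deriv ?_
  rcases k with _ | k
  · simp
  · rw [Nat.add_sub_cancel]
    field_simp
    ring

/-- `1/r(u, v)^k → 0` as `u → −∞` (`k ≥ 1`). [folklore] -/
lemma tendsto_inv_pow_atBot (hr : IsEFAreaRadius M r) (hM : 0 ≤ M) {k : ℕ} (hk : 1 ≤ k) (v : ℝ) :
    Tendsto (fun u ↦ 1 / r u v ^ k) atBot (𝓝 0) := by
  have h1 : Tendsto (fun u ↦ r u v ^ k) atBot atTop :=
    (tendsto_pow_atTop (by omega : k ≠ 0)).comp (hr.tendsto_atBot hM v)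
  refine h1.inv_tendsto_atTop.congr fun u ↦ ?_
  simp [one_div]

/-- **Integration towards `𝓘⁻` against inverse powers of `r`.** On a region `r ≥ 4M`: if
`|Z'(s)| ≤ A/r(s, x)^{k+1}` for `s ≤ U` and `Z → L` as `s → −∞`, then
`|Z(u) − L| ≤ (2A/k)/r(u, x)^k` for `u ≤ U` (comparison with the primitive `(2A/k)/r^k`, whose
`u`-derivative `2A(1 − 2M/r)/r^{k+1}` dominates `A/r^{k+1}`). [folklore] -/
theorem abs_sub_lim_le_inv_pow (hr : IsEFAreaRadius M r) (hM : 0 ≤ M) {x U : ℝ}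
    (h4 : 4 * M ≤ r U x) {Z Z' : ℝ → ℝ} (hZ : ∀ s ≤ U, HasDerivAt Z (Z' s) s) {A : ℝ}
    {k : ℕ} (hk : 1 ≤ k) (hle : ∀ s ≤ U, |Z' s| ≤ A / r s x ^ (k + 1)) {L : ℝ}
    (hlim : Tendsto Z atBot (𝓝 L)) {u : ℝ} (hu : u ≤ U) :
    |Z u - L| ≤ 2 * A / k / r u x ^ k := by
  have hk0 : (0 : ℝ) < k := by exact_mod_cast hk
  have hφ : ∀ s ≤ U, HasDerivAt (fun s ↦ 2 * A / k / r s x ^ k)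
      (2 * A / k * (k * (1 - 2 * M / r s x) / r s x ^ (k + 1))) s := fun s _ ↦ by
    have := (hr.hasDerivAt_inv_pow_fst hM k s x).const_mul (2 * A / k)
    simpa [div_eq_mul_inv, mul_assoc] using this
  have h := abs_sub_lim_le_of_abs_deriv_le hZ hφ (fun s hs ↦ ?_) hlim
    (by simpa [div_eq_mul_inv] using (hr.tendsto_inv_pow_atBot hM hk x).const_mul (2 * A / k)) hu
  · simpa using h
  · have hrs : 4 * M ≤ r s x := h4.trans (hr.antitone_fst hM x hs.le)
    have hD := hr.half_le_factor hM hrs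
    have hr0 := hr.pos hM s x
    have hpk : 0 < r s x ^ (k + 1) := pow_pos hr0 _
    have hA : 0 ≤ A := by
      by_contra hA
      push Not at hA
      exact absurd ((abs_nonneg _).trans (hle s hs.le)) (not_le.2 (div_neg_of_neg_of_pos hA hpk))
    refine (hle s hs.le).trans ?_
    rw [show 2 * A / k * (k * (1 - 2 * M / r s x) / r s x ^ (k + 1)) =
      (2 * (1 - 2 * M / r s x)) * (A / r s x ^ (k + 1)) by field_simp]
    have hA' : 0 ≤ A / r s x ^ (k + 1) := div_nonneg hA hpk.le
    nlinarith

/-- **Integration along an outgoing cone against inverse powers of `r`.** On `r ≥ 4M`: if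
`|Z'(y)| ≤ A/r(u, y)^{k+1}` for `y ∈ [a, b]`, then `|Z(b) − Z(a)| ≤ (2A/k)(1/r(u,a)^k − 1/r(u,b)^k)`.
[folklore] -/
theorem abs_sub_le_inv_pow_snd (hr : IsEFAreaRadius M r) (hM : 0 ≤ M) {u a b : ℝ} (hab : a ≤ b)
    (h4 : 4 * M ≤ r u a) {Z Z' : ℝ → ℝ} (hZ : ∀ y ∈ Icc a b, HasDerivAt Z (Z' y) y) {A : ℝ}
    {k : ℕ} (hk : 1 ≤ k) (hle : ∀ y ∈ Icc a b, |Z' y| ≤ A / r u y ^ (k + 1)) :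
    |Z b - Z a| ≤ 2 * A / k * (1 / r u a ^ k - 1 / r u b ^ k) := by
  have hk0 : (0 : ℝ) < k := by exact_mod_cast hk
  have hφ : ∀ y ∈ Icc a b, HasDerivAt (fun y ↦ -(2 * A / k / r u y ^ k))
      (-(2 * A / k * -(k * (1 - 2 * M / r u y) / r u y ^ (k + 1)))) y := fun y _ ↦ by
    have := ((hr.hasDerivAt_inv_pow_snd hM k u y).const_mul (2 * A / k)).fun_neg
    simpa [div_eq_mul_inv, mul_assoc] using this
  have h := abs_sub_le_sub_of_abs_deriv_le (convex_Icc a b) hZ hφ (fun y hy ↦ ?_)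
    (left_mem_Icc.2 hab) (right_mem_Icc.2 hab) hab
  · have : -(2 * A / ↑k / r u b ^ k) - -(2 * A / ↑k / r u a ^ k) =
        2 * A / k * (1 / r u a ^ k - 1 / r u b ^ k) := by ring
    rwa [this] at h
  · rw [interior_Icc] at hy
    have hy' : y ∈ Icc a b := Ioo_subset_Icc_self hy
    have hry : 4 * M ≤ r u y := h4.trans (hr.monotone_snd hM u hy'.1)
    have hD := hr.half_le_factor hM hry
    have hr0 := hr.pos hM u y
    have hpk : 0 < r u y ^ (k + 1) := pow_pos hr0 _
    have hA : 0 ≤ A := by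
      by_contra hA
      push Not at hA
      exact absurd ((abs_nonneg _).trans (hle y hy')) (not_le.2 (div_neg_of_neg_of_pos hA hpk))
    refine (hle y hy').trans ?_
    rw [show -(2 * A / k * -(k * (1 - 2 * M / r u y) / r u y ^ (k + 1))) =
      (2 * (1 - 2 * M / r u y)) * (A / r u y ^ (k + 1)) by field_simp]
    have hA' : 0 ≤ A / r u y ^ (k + 1) := div_nonneg hA hpk.le
    nlinarith

/-! ### The tortoise identity and the comparison of `r(u, v₂)` with `|u|` -/

/-- **Tortoise identity**: `r + 2M log(r − 2M) − (v − u)` is constant (its `u`- and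
`v`-derivatives vanish by `∂ᵥr = −∂ᵤr = 1 − 2M/r`); this is `r* = v − u` up to the free
additive constant of the tortoise coordinate `r* = r + 2M log(r − 2M)` (Kehrberger, §3.2).
[cite: Kehrberger2022AHP, §3.2] -/
theorem exists_tortoise_const (hr : IsEFAreaRadius M r) (hM : 0 ≤ M) :
    ∃ c : ℝ, ∀ u v, r u v + 2 * M * Real.log (r u v - 2 * M) = v - u + c := by
  set τ : ℝ → ℝ → ℝ := fun u v ↦ r u v + 2 * M * Real.log (r u v - 2 * M) + u - v with hτ
  have hsub : ∀ u v, r u v - 2 * M ≠ 0 := fun u v ↦ (sub_pos.2 (hr.1 u v)).ne'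
  -- `∂ᵤ τ = 0`
  have hdu : ∀ v u, HasDerivAt (fun u' ↦ τ u' v) 0 u := by
    intro v u
    have h1 := hr.hasDerivAt_fst u v
    have h2 := ((h1.sub_const (2 * M)).log (hsub u v)).const_mul (2 * M)
    have h3 := ((h1.fun_add h2).fun_add (hasDerivAt_id u)).sub_const v
    refine (h3.congr_deriv ?_).congr_of_eventuallyEq (Eventually.of_forall fun u' ↦ by
      simp only [hτ, id])
    have hr0 : r u v ≠ 0 := (hr.pos hM u v).ne'
    have hs : r u v - 2 * M ≠ 0 := hsub u v
    field_simp
    ring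
  have hdv : ∀ u v, HasDerivAt (fun v' ↦ τ u v') 0 v := by
    intro u v
    have h1 := hr.hasDerivAt_snd u v
    have h2 := ((h1.sub_const (2 * M)).log (hsub u v)).const_mul (2 * M)
    have h3 := ((h1.fun_add h2).const_add u).fun_sub (hasDerivAt_id v)
    refine (h3.congr_deriv ?_).congr_of_eventuallyEq (Eventually.of_forall fun v' ↦ by
      simp only [hτ, id]; ring)
    have hr0 : r u v ≠ 0 := (hr.pos hM u v).ne'
    have hs : r u v - 2 * M ≠ 0 := hsub u v
    field_simp
    ring
  have hcu : ∀ v u, τ u v = τ 0 v := fun v u ↦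
    is_const_of_deriv_eq_zero (fun u' ↦ (hdu v u').differentiableAt)
      (fun u' ↦ (hdu v u').deriv) u 0
  have hcv : ∀ v, τ 0 v = τ 0 0 := fun v ↦
    is_const_of_deriv_eq_zero (fun v' ↦ (hdv 0 v').differentiableAt)
      (fun v' ↦ (hdv 0 v').deriv) v 0
  refine ⟨τ 0 0, fun u v ↦ ?_⟩
  have := (hcu v u).trans (hcv v)
  simp only [hτ] at this ⊢
  linarith

/-- **`r(u, v₂)` versus `|u|` towards `𝓘⁻` (EF gauge).** Along the ingoing cone `v = v₂`,
`|r(u, v₂) − |u| | ≤ K log|u|` and `|u|/2 ≤ r(u, v₂) ≤ 2|u|` for all `u ≤ U` (some `U ≤ −e`, `K`):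
from the tortoise identity `r + 2M log(r − 2M) = v₂ − u + c`. This logarithmic discrepancy is the
source of the `log|u|` in (6.17) ("the `O(|u|⁻³)`-term in (6.3) is replaced by an
`O(|u|⁻³ log|u|)`-term", Kehrberger, §6.2, footnote). [cite: Kehrberger2022AHP, §6.2 footnote 55] -/
theorem abs_sub_abs_le_log (hr : IsEFAreaRadius M r) (hM : 0 ≤ M) (v₂ : ℝ) :
    ∃ U : ℝ, U ≤ -Real.exp 1 ∧ ∃ K : ℝ, 0 ≤ K ∧ ∀ u ≤ U,
      |r u v₂ - (|u|)| ≤ K * Real.log |u| ∧ |u| / 2 ≤ r u v₂ ∧ r u v₂ ≤ 2 * |u| := by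
  obtain ⟨c, hc⟩ := hr.exists_tortoise_const hM
  set a := v₂ + c with ha
  set K := |a| + 4 * M with hK
  have hK0 : 0 ≤ K := by positivity
  -- (1) eventually `r(u, v₂) − 2M ≥ 1`
  obtain ⟨U₁, hU₁⟩ := ((hr.tendsto_atBot hM v₂).eventually_ge_atTop (2 * M + 1)).exists_forall_of_atBot
  -- (2) eventually `K log|u| ≤ |u|/2`
  have hlo : ∀ᶠ x in atTop, ‖Real.log x‖ ≤ 1 / (2 * (K + 1)) * ‖x‖ :=
    Real.isLittleO_log_id_atTop.bound (by positivity)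
  obtain ⟨X, hX⟩ := hlo.exists_forall_of_atTop
  refine ⟨min (min U₁ (-X)) (min (-Real.exp 1) (-|a|)), (min_le_right _ _).trans (min_le_left _ _),
    K, hK0, fun u hu ↦ ?_⟩
  have hu₁ : u ≤ U₁ := hu.trans ((min_le_left _ _).trans (min_le_left _ _))
  have huX : X ≤ -u := by linarith [hu.trans ((min_le_left _ _).trans (min_le_right _ _))]
  have hue : u ≤ -Real.exp 1 := hu.trans ((min_le_right _ _).trans (min_le_left _ _))
  have hua : |a| ≤ -u := by linarith [hu.trans ((min_le_right _ _).trans (min_le_right _ _))]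
  have he1 : (2 : ℝ) ≤ Real.exp 1 := by linarith [Real.add_one_le_exp (1 : ℝ)]
  have hu0 : u < 0 := by linarith [Real.exp_pos 1]
  have habs : |u| = -u := abs_of_neg hu0
  have hu3 : Real.exp 1 ≤ |u| := by rw [habs]; linarith
  have hlog1 : 1 ≤ Real.log |u| := by
    rw [Real.le_log_iff_exp_le (by linarith)]; exact hu3
  set ρ := r u v₂ with hρ
  have hρ1 : 2 * M + 1 ≤ ρ := hU₁ u hu₁
  have hρpos : 0 < ρ - 2 * M := by linarith
  have htort : ρ + 2 * M * Real.log (ρ - 2 * M) = a + |u| := by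
    rw [hρ, hc u v₂, habs, ha]; ring
  have hlog0 : 0 ≤ Real.log (ρ - 2 * M) := Real.log_nonneg (by linarith)
  -- upper bound `ρ ≤ a + |u|`
  have hup : ρ ≤ a + |u| := by nlinarith
  -- `log(ρ − 2M) ≤ 2 log|u|`
  have hlogle : Real.log (ρ - 2 * M) ≤ 2 * Real.log |u| := by
    have h1 : Real.log (ρ - 2 * M) ≤ Real.log (2 * |u|) := by
      rw [Real.log_le_log_iff hρpos (by linarith)]
      have : |a| ≤ |u| := by rw [habs]; exact hua
      linarith [le_abs_self a]
    have h2 : Real.log (2 * |u|) = Real.log 2 + Real.log |u| :=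
      Real.log_mul (by norm_num) (by linarith)
    have h3 : Real.log 2 ≤ 1 := by
      rw [Real.log_le_iff_le_exp (by norm_num)]; exact he1
    linarith
  -- lower bound `ρ ≥ a + |u| − 4M log|u|`
  have hlow : a + |u| - 4 * M * Real.log |u| ≤ ρ := by nlinarith
  have hmain : |ρ - (|u|)| ≤ K * Real.log |u| := by
    rw [abs_le, hK]
    constructor
    · nlinarith [abs_nonneg a, neg_abs_le a]
    · nlinarith [abs_nonneg a, le_abs_self a]
  -- comparability
  have hKlog : K * Real.log |u| ≤ |u| / 2 := by
    have h := hX (-u) huX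
    rw [Real.norm_eq_abs, Real.norm_eq_abs, ← habs, abs_of_nonneg (by linarith : 0 ≤ Real.log |u|),
      abs_abs] at h
    have hK1 : 0 < K + 1 := by linarith
    calc K * Real.log |u| ≤ K * (1 / (2 * (K + 1)) * |u|) :=
          mul_le_mul_of_nonneg_left h hK0
      _ = (K / (K + 1)) * (|u| / 2) := by field_simp
      _ ≤ 1 * (|u| / 2) := by
          gcongr
          rw [div_le_one hK1]; linarith
      _ = |u| / 2 := one_mul _
  refine ⟨hmain, ?_, ?_⟩
  · have := (abs_le.1 hmain).1; linarith
  · have := (abs_le.1 hmain).2; linarith [abs_nonneg u]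

/-- **Inverse powers of `r(u, v₂)` versus inverse powers of `|u|`**: with `U`, `K` as in
`abs_sub_abs_le_log`, for every `k` there is `C` with
`|1/r(u,v₂)^k − 1/|u|^k| ≤ C log|u|/|u|^{k+1}` for `u ≤ U`. [folklore] -/
theorem abs_inv_pow_sub_inv_pow_le (hr : IsEFAreaRadius M r) (hM : 0 ≤ M) (v₂ : ℝ) :
    ∃ U : ℝ, U ≤ -Real.exp 1 ∧ (∀ u ≤ U, |u| / 2 ≤ r u v₂ ∧ r u v₂ ≤ 2 * |u|) ∧
      ∀ k : ℕ, ∃ C : ℝ, 0 ≤ C ∧ ∀ u ≤ U,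
        |1 / r u v₂ ^ k - 1 / |u| ^ k| ≤ C * Real.log |u| / |u| ^ (k + 1) := by
  obtain ⟨U, hU, K, hK0, h⟩ := hr.abs_sub_abs_le_log hM v₂
  refine ⟨U, hU, fun u hu ↦ ⟨(h u hu).2.1, (h u hu).2.2⟩, fun k ↦ ?_⟩
  have he1 : (2 : ℝ) ≤ Real.exp 1 := by linarith [Real.add_one_le_exp (1 : ℝ)]
  have hupos : ∀ u ≤ U, 2 ≤ |u| := fun u hu ↦ by
    have hu0 : u < 0 := by linarith [Real.exp_pos 1, hu.trans hU]
    rw [abs_of_neg hu0]; linarith [hu.trans hU]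
  have hlog0 : ∀ u ≤ U, 0 ≤ Real.log |u| := fun u hu ↦ Real.log_nonneg (by linarith [hupos u hu])
  induction k with
  | zero => exact ⟨0, le_rfl, fun u hu ↦ by simp⟩
  | succ k ih =>
    obtain ⟨C, hC0, hC⟩ := ih
    refine ⟨2 * C + 2 * K, by positivity, fun u hu ↦ ?_⟩
    obtain ⟨hmain, hlow, hup⟩ := h u hu
    have hu2 := hupos u hu
    have hu0 : 0 < |u| := by linarith
    set ρ := r u v₂ with hρ
    have hρ0 : 0 < ρ := by linarith
    have hsplit : 1 / ρ ^ (k + 1) - 1 / |u| ^ (k + 1) =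
        (1 / ρ) * (1 / ρ ^ k - 1 / |u| ^ k) + (1 / |u| ^ k) * (1 / ρ - 1 / |u|) := by
      field_simp
      ring
    have h1 : |1 / ρ| ≤ 2 / |u| := by
      rw [abs_of_pos (by positivity), div_le_div_iff₀ hρ0 hu0]; linarith
    have h2 : |1 / ρ - 1 / (|u|)| ≤ 2 * K * Real.log |u| / |u| ^ 2 := by
      rw [div_sub_div _ _ hρ0.ne' hu0.ne', one_mul, mul_one, abs_div,
        abs_of_pos (mul_pos hρ0 hu0), abs_sub_comm]
      rw [div_le_div_iff₀ (mul_pos hρ0 hu0) (by positivity)]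
      calc |ρ - (|u|)| * |u| ^ 2 ≤ K * Real.log |u| * |u| ^ 2 := by gcongr
        _ = K * Real.log |u| * |u| * |u| := by ring
        _ ≤ K * Real.log |u| * |u| * (2 * ρ) := by
            have hnn : 0 ≤ K * Real.log |u| * |u| := mul_nonneg (mul_nonneg hK0 (hlog0 u hu)) hu0.le
            have h2ρ : |u| ≤ 2 * ρ := by linarith
            exact mul_le_mul_of_nonneg_left h2ρ hnn
        _ = 2 * K * Real.log |u| * (ρ * |u|) := by ring
    have h3 : |1 / |u| ^ k| = 1 / |u| ^ k := abs_of_pos (by positivity)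
    calc |1 / ρ ^ (k + 1) - 1 / |u| ^ (k + 1)|
        = |(1 / ρ) * (1 / ρ ^ k - 1 / |u| ^ k) + (1 / |u| ^ k) * (1 / ρ - 1 / |u|)| := by rw [hsplit]
      _ ≤ |1 / ρ| * |1 / ρ ^ k - 1 / |u| ^ k| + |1 / |u| ^ k| * |1 / ρ - 1 / (|u|)| := by
          refine (abs_add_le _ _).trans ?_; rw [abs_mul, abs_mul]
      _ ≤ (2 / |u|) * (C * Real.log |u| / |u| ^ (k + 1)) +
            (1 / |u| ^ k) * (2 * K * Real.log |u| / |u| ^ 2) := by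
          rw [h3]
          gcongr
          · exact hC u hu
      _ = (2 * C + 2 * K) * Real.log |u| / |u| ^ (k + 1 + 1) := by
          field_simp
          ring

end IsEFAreaRadius

/-! ### Smoothness of the slices of `r` and `V` -/

namespace IsEFAreaRadius

variable {M : ℝ} {r : ℝ → ℝ → ℝ}

/-- The slices `u ↦ r(u, v)` are smooth (`∂ᵤr = −(1 − 2M/r)` is a smooth function of `r > 0`;
bootstrap). [folklore] -/
theorem contDiff_fst (hr : IsEFAreaRadius M r) (hM : 0 ≤ M) (v : ℝ) :
    ContDiff ℝ ((⊤ : ℕ∞) : WithTop ℕ∞) (fun u ↦ r u v) := by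
  have hd : ∀ u, HasDerivAt (fun u ↦ r u v) (-(1 - 2 * M / r u v)) u := fun u ↦ hr.hasDerivAt_fst u v
  have hderiv : deriv (fun u ↦ r u v) = fun u ↦ -(1 - 2 * M / r u v) := funext fun u ↦ (hd u).deriv
  have hdiff : Differentiable ℝ (fun u ↦ r u v) := fun u ↦ (hd u).differentiableAt
  have hne : ∀ u, r u v ≠ 0 := fun u ↦ (hr.pos hM u v).ne'
  have key : ∀ n : ℕ, ContDiff ℝ n (fun u ↦ r u v) := by
    intro n
    induction n with
    | zero => exact contDiff_zero.2 hdiff.continuous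
    | succ n ih =>
      rw [show ((n + 1 : ℕ) : WithTop ℕ∞) = (n : WithTop ℕ∞) + 1 by push_cast; rfl,
        contDiff_succ_iff_deriv]
      refine ⟨hdiff, fun h ↦ absurd h (by exact_mod_cast WithTop.coe_ne_top), ?_⟩
      rw [hderiv]
      exact (contDiff_const.sub (contDiff_const.div ih hne)).neg
  exact contDiff_infty.2 key

/-- The slices `v ↦ r(u, v)` are smooth. [folklore] -/
theorem contDiff_snd (hr : IsEFAreaRadius M r) (hM : 0 ≤ M) (u : ℝ) :
    ContDiff ℝ ((⊤ : ℕ∞) : WithTop ℕ∞) (fun v ↦ r u v) := by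
  have hd : ∀ v, HasDerivAt (fun v ↦ r u v) (1 - 2 * M / r u v) v := fun v ↦ hr.hasDerivAt_snd u v
  have hderiv : deriv (fun v ↦ r u v) = fun v ↦ 1 - 2 * M / r u v := funext fun v ↦ (hd v).deriv
  have hdiff : Differentiable ℝ (fun v ↦ r u v) := fun v ↦ (hd v).differentiableAt
  have hne : ∀ v, r u v ≠ 0 := fun v ↦ (hr.pos hM u v).ne'
  have key : ∀ n : ℕ, ContDiff ℝ n (fun v ↦ r u v) := by
    intro n
    induction n with
    | zero => exact contDiff_zero.2 hdiff.continuous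
    | succ n ih =>
      rw [show ((n + 1 : ℕ) : WithTop ℕ∞) = (n : WithTop ℕ∞) + 1 by push_cast; rfl,
        contDiff_succ_iff_deriv]
      refine ⟨hdiff, fun h ↦ absurd h (by exact_mod_cast WithTop.coe_ne_top), ?_⟩
      rw [hderiv]
      exact contDiff_const.sub (contDiff_const.div ih hne)
  exact contDiff_infty.2 key

end IsEFAreaRadius

/-- The `u`-slices of the potential `V = −2M(1 − 2M/r)/r³` are smooth. [folklore] -/
theorem contDiff_efPotential_fst {M : ℝ} {r : ℝ → ℝ → ℝ} (hr : IsEFAreaRadius M r) (hM : 0 ≤ M)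
    (v : ℝ) : ContDiff ℝ ((⊤ : ℕ∞) : WithTop ℕ∞) (fun u ↦ efPotential M r u v) := by
  have h := hr.contDiff_fst hM v
  have hne : ∀ u, r u v ≠ 0 := fun u ↦ (hr.pos hM u v).ne'
  unfold efPotential
  exact (contDiff_const.mul (contDiff_const.sub (contDiff_const.div h hne))).div (h.pow 3)
    fun u ↦ pow_ne_zero 3 (hne u)

/-! ### The weight `P` on `r ≥ 4M` -/

/-- On `r(u, x) ≥ 4M`: `P(u) = efWeight M r x u ≤ 4M/r(u, x)²`
(`−log(1 − y) ≤ y + 2y²` for `0 ≤ y ≤ 1/2`, `y = 2M/r`). [folklore] -/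
lemma efWeight_le_of_le {M : ℝ} {r : ℝ → ℝ → ℝ} (hM : 0 < M) (hr : IsEFAreaRadius M r) {x u : ℝ}
    (h4 : 4 * M ≤ r u x) : efWeight M r x u ≤ 4 * M / r u x ^ 2 := by
  set ρ := r u x with hρ
  have hρ0 : 0 < ρ := hr.pos hM.le u x
  set y := 2 * M / ρ with hy
  have hy0 : 0 ≤ y := by positivity
  have hy2 : y ≤ 1 / 2 := by
    rw [hy, div_le_iff₀ hρ0]; linarith
  have hy1 : |y| < 1 := by rw [abs_of_nonneg hy0]; linarith
  have hlog : -Real.log (1 - y) ≤ y + 2 * y ^ 2 := by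
    have h := Real.abs_log_sub_add_sum_range_le hy1 1
    simp only [Finset.sum_range_one, Nat.cast_zero, zero_add, pow_one, div_one] at h
    rw [abs_of_nonneg hy0] at h
    have h' := (abs_le.1 h).1
    have h1y : y ^ (1 + 1) / (1 - y) ≤ 2 * y ^ 2 := by
      rw [div_le_iff₀ (by linarith), show y ^ (1 + 1) = y ^ 2 by norm_num]
      nlinarith [sq_nonneg y]
    linarith
  rw [efWeight]
  have hM2 : 0 < 2 * M := by linarith
  have key : -(Real.log (1 - y) / (2 * M)) ≤ (y + 2 * y ^ 2) / (2 * M) := by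
    rw [← neg_div]; exact div_le_div_of_nonneg_right hlog hM2.le
  have hcalc : (y + 2 * y ^ 2) / (2 * M) - ρ⁻¹ = 4 * M / ρ ^ 2 := by
    rw [hy]; field_simp; ring
  calc -(Real.log (1 - y) / (2 * M) + ρ⁻¹) = -(Real.log (1 - y) / (2 * M)) - ρ⁻¹ := by ring
    _ ≤ (y + 2 * y ^ 2) / (2 * M) - ρ⁻¹ := by linarith
    _ = 4 * M / ρ ^ 2 := hcalc

/-! ### Representation formulas for scattering solutions -/

namespace IsScatteringSolution

variable {M : ℝ} {r : ℝ → ℝ → ℝ} {v₁ : ℝ} {G : ℝ → ℝ} {ψ : ℝ → ℝ → ℝ}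

/-- A scattering solution is jointly smooth. [folklore] -/
lemma contDiff (h : IsScatteringSolution M r v₁ G ψ) :
    ContDiff ℝ ((⊤ : ℕ∞) : WithTop ℕ∞) (Function.uncurry ψ) := h.isRadiationField.1

/-- `∂ᵤψ` vanishes on `{v ≤ v₁}` (there `ψ ≡ 0`). [folklore] -/
lemma partialU_eq_zero (h : IsScatteringSolution M r v₁ G ψ) (u : ℝ) {v : ℝ} (hv : v ≤ v₁) :
    partialU ψ u v = 0 := by
  have : (fun u' ↦ ψ u' v) = fun _ ↦ 0 := funext fun u' ↦ h.eq_zero hv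
  rw [partialU, this, deriv_const]

/-- The data are attained: on `{v ≤ v₁}` the data vanish, `G(v) = 0`. [folklore] -/
lemma data_eq_zero (h : IsScatteringSolution M r v₁ G ψ) {v : ℝ} (hv : v ≤ v₁) : G v = 0 := by
  have h1 : Tendsto (fun u ↦ ψ u v) atBot (𝓝 0) := by
    simp only [h.eq_zero hv]; exact tendsto_const_nhds
  exact tendsto_nhds_unique (h.tendsto_atBot v) h1

/-- **`∂ᵤψ` is the `v`-integral of `Vψ` from `v₁`**: `∂ᵤψ(u, v) = ∫_{v₁}^{v} V(u, x) ψ(u, x) dx`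
(both sides vanish at `v = v₁` and have `v`-derivative `∂ᵥ∂ᵤψ = ∂ᵤ∂ᵥψ = Vψ`).
[cite: Kehrberger2022AHP, §6.2 eq. (6.14)] -/
theorem partialU_eq_integral (hM : 0 < M) (hr : IsEFAreaRadius M r)
    (h : IsScatteringSolution M r v₁ G ψ) (u v : ℝ) :
    partialU ψ u v = ∫ x in v₁..v, efPotential M r u x * ψ u x := by
  have hψ := h.contDiff
  have hcont : Continuous fun x ↦ efPotential M r u x * ψ u x :=
    (continuous_efPotential_snd hM hr u).mul (h.isRadiationField.continuous_snd u)
  -- the difference has zero derivative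
  have hd : ∀ x, HasDerivAt (fun x ↦ partialU ψ u x - ∫ y in v₁..x, efPotential M r u y * ψ u y) 0 x := by
    intro x
    have h1 : HasDerivAt (fun x ↦ partialU ψ u x) (partialV (partialU ψ) u x) x :=
      hasDerivAt_partialV (contDiff_partialU hψ) u x
    have h2 : HasDerivAt (fun x ↦ ∫ y in v₁..x, efPotential M r u y * ψ u y)
        (efPotential M r u x * ψ u x) x :=
      intervalIntegral.integral_hasDerivAt_right (hcont.intervalIntegrable _ _)
        (hcont.stronglyMeasurableAtFilter _ _) hcont.continuousAt
    refine (h1.sub h2).congr_deriv ?_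
    rw [partialV_partialU_eq hψ, h.isRadiationField.partialU_partialV, sub_self]
  have hconst := is_const_of_deriv_eq_zero (fun x ↦ (hd x).differentiableAt)
    (fun x ↦ (hd x).deriv) v v₁
  simp only [intervalIntegral.integral_same, sub_zero, h.partialU_eq_zero u le_rfl] at hconst
  linarith

/-- The slice `u ↦ ψ(u, v)` has derivative `∂ᵤψ`. [folklore] -/
lemma hasDerivAt_fst (h : IsScatteringSolution M r v₁ G ψ) (u v : ℝ) :
    HasDerivAt (fun u' ↦ ψ u' v) (partialU ψ u v) u := hasDerivAt_partialU h.contDiff u v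

/-- The slice `v ↦ ψ(u, v)` has derivative `∂ᵥψ`. [folklore] -/
lemma hasDerivAt_snd (h : IsScatteringSolution M r v₁ G ψ) (u v : ℝ) :
    HasDerivAt (fun v' ↦ ψ u v') (partialV ψ u v) v := hasDerivAt_partialV h.contDiff u v

/-- `∂ᵥψ(·, x)` has `u`-derivative `Vψ`. [folklore] -/
lemma hasDerivAt_partialV_fst (h : IsScatteringSolution M r v₁ G ψ) (u x : ℝ) :
    HasDerivAt (fun u' ↦ partialV ψ u' x) (efPotential M r u x * ψ u x) u :=
  h.isRadiationField.hasDerivAt_partialV_fst u x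

/-- **Bound on `∂ᵤψ` from a bound on `ψ`**: if `|ψ(u, y)| ≤ m` for `y ∈ [v₁, x]`, then
`|∂ᵤψ(u, x)| ≤ (x − v₁) · (2M/r(u, v₁)³) · m`. [folklore] -/
theorem abs_partialU_le (hM : 0 < M) (hr : IsEFAreaRadius M r)
    (h : IsScatteringSolution M r v₁ G ψ) {u x m : ℝ} (hx : v₁ ≤ x)
    (hm : ∀ y ∈ Icc v₁ x, |ψ u y| ≤ m) :
    |partialU ψ u x| ≤ (x - v₁) * (efPotentialBound M r v₁ u * m) := by
  rw [h.partialU_eq_integral hM hr]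
  have key := intervalIntegral.norm_integral_le_of_norm_le_const (a := v₁) (b := x)
    (C := efPotentialBound M r v₁ u * m) (f := fun y ↦ efPotential M r u y * ψ u y) fun y hy ↦ ?_
  · rw [abs_of_nonneg (sub_nonneg.2 hx)] at key
    rw [mul_comm (x - v₁)]
    exact key
  · rw [uIoc_of_le hx] at hy
    rw [Real.norm_eq_abs, abs_mul]
    exact mul_le_mul (abs_efPotential_le_bound hM hr u hy.1.le) (hm y ⟨hy.1.le, hy.2⟩)
      (abs_nonneg _) (efPotentialBound_nonneg hM hr u)

/-- **Approach to the data**: if `|ψ(s, y)| ≤ m` for all `s ≤ u`, `y ∈ [v₁, x]`, then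
`|ψ(u, x) − G(x)| ≤ (x − v₁) m P(u)` with `P = efWeight M r v₁` (integrate `|∂ᵤψ| ≤ (x − v₁) m ∂ᵤP`
from `𝓘⁻`, where `ψ → G`). [folklore] -/
theorem abs_sub_data_le (hM : 0 < M) (hr : IsEFAreaRadius M r)
    (h : IsScatteringSolution M r v₁ G ψ) {u x m : ℝ} (hx : v₁ ≤ x)
    (hm : ∀ s ≤ u, ∀ y ∈ Icc v₁ x, |ψ s y| ≤ m) :
    |ψ u x - G x| ≤ (x - v₁) * m * efWeight M r v₁ u := by
  have hφ : ∀ s ≤ u, HasDerivAt (fun s ↦ (x - v₁) * m * efWeight M r v₁ s)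
      ((x - v₁) * m * efPotentialBound M r v₁ s) s := fun s _ ↦
    (hasDerivAt_efWeight hM hr s).const_mul _
  have key := abs_sub_lim_le_of_abs_deriv_le (fun s _ ↦ h.hasDerivAt_fst s x) hφ
    (fun s hs ↦ ?_) (h.tendsto_atBot x)
    ((tendsto_efWeight_atBot hM hr).const_mul ((x - v₁) * m)) le_rfl
  · simpa using key
  · have := h.abs_partialU_le hM hr hx (hm s hs.le)
    simpa [mul_comm, mul_assoc, mul_left_comm] using this

/-- **The transversal derivative `∂ᵥψ` converges at `𝓘⁻`, locally uniformly.** There is a function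
`e` with `∂ᵥψ(u, x) → e(x)` as `u → −∞` and, on every past quadrant `{u ≤ U, x ≤ X}`,
`|∂ᵥψ(u, x) − e(x)| ≤ B · P(u)` for a constant `B` (`P = efWeight M r v₁ → 0`): `∂ᵤ∂ᵥψ = Vψ` with
`|Vψ| ≤ B ∂ᵤP`, Cauchy criterion. [folklore] -/
theorem exists_partialV_limit (hM : 0 < M) (hr : IsEFAreaRadius M r)
    (h : IsScatteringSolution M r v₁ G ψ) :
    ∃ e : ℝ → ℝ, (∀ x, Tendsto (fun u ↦ partialV ψ u x) atBot (𝓝 (e x))) ∧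
      ∀ U X : ℝ, ∃ B : ℝ, 0 ≤ B ∧ ∀ u ≤ U, ∀ x ≤ X,
        |partialV ψ u x - e x| ≤ B * efWeight M r v₁ u := by
  -- the derivative bound on a past quadrant
  have hbound : ∀ U X : ℝ, ∃ B : ℝ, 0 ≤ B ∧ ∀ s ≤ U, ∀ x ≤ X,
      |efPotential M r s x * ψ s x| ≤ B * efPotentialBound M r v₁ s := by
    intro U X
    obtain ⟨B, hB⟩ := h.exists_bound U X
    refine ⟨max B 0, le_max_right _ _, fun s hs x hx ↦ ?_⟩
    rcases le_or_gt x v₁ with hxv | hxv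
    · rw [h.eq_zero hxv, mul_zero, abs_zero]
      exact mul_nonneg (le_max_right _ _) (efPotentialBound_nonneg hM hr s)
    · rw [abs_mul, mul_comm]
      exact mul_le_mul ((hB s hs x hx).trans (le_max_left _ _))
        (abs_efPotential_le_bound hM hr s hxv.le) (abs_nonneg _) (le_max_right _ _)
  -- increments of `∂ᵥψ(·, x)` towards the past
  have hincr : ∀ U X : ℝ, ∃ B : ℝ, 0 ≤ B ∧ ∀ x ≤ X, ∀ u' u, u' ≤ u → u ≤ U →
      |partialV ψ u x - partialV ψ u' x| ≤ B * (efWeight M r v₁ u - efWeight M r v₁ u') := by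
    intro U X
    obtain ⟨B, hB0, hB⟩ := hbound U X
    refine ⟨B, hB0, fun x hx u' u hu' hu ↦ ?_⟩
    have key := abs_sub_le_sub_of_abs_deriv_le (convex_Iic U)
      (fun s _ ↦ h.hasDerivAt_partialV_fst s x)
      (fun s _ ↦ (hasDerivAt_efWeight hM hr s).const_mul B)
      (fun s hs ↦ hB s (interior_subset (s := Iic U) hs) x hx) (hu'.trans hu) hu hu'
    simpa [mul_sub] using key
  -- pointwise Cauchy, hence convergent
  have hconv : ∀ x, ∃ L, Tendsto (fun u ↦ partialV ψ u x) atBot (𝓝 L) := by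
    intro x
    obtain ⟨B, hB0, hB⟩ := hincr 0 x
    set g : ℝ → ℝ := fun t ↦ partialV ψ (-t) x with hg
    have hcauchy : CauchySeq g := by
      rw [Metric.cauchySeq_iff']
      intro ε hε
      have hP := tendsto_efWeight_atBot hM hr (r := r) (v₁ := v₁)
      have hev : ∀ᶠ s in atBot, efWeight M r v₁ s < ε / (B + 1) :=
        hP.eventually (gt_mem_nhds (by positivity))
      obtain ⟨N₀, hN₀⟩ := hev.exists_forall_of_atBot
      refine ⟨max 0 (-N₀), fun n hn ↦ ?_⟩
      have hn0 : -n ≤ -max 0 (-N₀) := neg_le_neg hn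
      have hN : -max 0 (-N₀) ≤ (0 : ℝ) := by simp
      have hN' : -max 0 (-N₀) ≤ N₀ := by
        have := le_max_right (0 : ℝ) (-N₀); linarith
      have key := hB x le_rfl (-n) (-max 0 (-N₀)) hn0 hN
      rw [Real.dist_eq, abs_sub_comm, hg]
      have hPn := efWeight_nonneg hM hr (v₁ := v₁) (r := r) (-n)
      have hPN := hN₀ _ hN'
      calc |partialV ψ (-max 0 (-N₀)) x - partialV ψ (-n) x|
          ≤ B * (efWeight M r v₁ (-max 0 (-N₀)) - efWeight M r v₁ (-n)) := key
        _ ≤ B * efWeight M r v₁ (-max 0 (-N₀)) := by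
            apply mul_le_mul_of_nonneg_left _ hB0; linarith
        _ ≤ B * (ε / (B + 1)) := mul_le_mul_of_nonneg_left hPN.le hB0
        _ < ε := by
            rw [mul_div_assoc']
            rw [div_lt_iff₀ (by positivity)]
            nlinarith
    obtain ⟨L, hL⟩ := cauchySeq_tendsto_of_complete hcauchy
    refine ⟨L, ?_⟩
    have := hL.comp tendsto_neg_atBot_atTop
    refine this.congr fun u ↦ ?_
    simp [hg]
  choose e he using hconv
  refine ⟨e, he, fun U X ↦ ?_⟩
  obtain ⟨B, hB0, hB⟩ := hbound U X
  refine ⟨B, hB0, fun u hu x hx ↦ ?_⟩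
  have key := abs_sub_lim_le_of_abs_deriv_le (fun s _ ↦ h.hasDerivAt_partialV_fst s x)
    (fun s _ ↦ (hasDerivAt_efWeight hM hr s).const_mul B)
    (fun s hs ↦ hB s hs.le x hx) (he x)
    ((tendsto_efWeight_atBot hM hr).const_mul B) hu
  simpa using key

/-- **The limit of `∂ᵥψ` at `𝓘⁻` is the derivative of the data**, `∂ᵥψ(u, x) → G'(x)`; in
particular `G` is differentiable with `G(x) = ∫_{v₁}^{x} lim_{u → −∞} ∂ᵥψ(u, y) dy` (uniform
convergence on past quadrants, `ψ(u, x) = ∫_{v₁}^{x} ∂ᵥψ(u, y) dy → G(x)`). This is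
"`∂ᵥ(rφ^T)(−∞, v) = (G^T)'(v)`" of the proof of Thm. 6.2. [cite: Kehrberger2022AHP, proof of Thm. 6.2, eq. (6.23)] -/
theorem tendsto_partialV_deriv (hM : 0 < M) (hr : IsEFAreaRadius M r)
    (h : IsScatteringSolution M r v₁ G ψ) :
    (∀ x, HasDerivAt G (deriv G x) x) ∧
      (∀ x, Tendsto (fun u ↦ partialV ψ u x) atBot (𝓝 (deriv G x))) ∧
      ∀ U X : ℝ, ∃ B : ℝ, 0 ≤ B ∧ ∀ u ≤ U, ∀ x ≤ X,
        |partialV ψ u x - deriv G x| ≤ B * efWeight M r v₁ u := by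
  obtain ⟨e, he, hB⟩ := h.exists_partialV_limit hM hr
  have hP := tendsto_efWeight_atBot hM hr (r := r) (v₁ := v₁)
  -- `e` is continuous (locally uniform limit of continuous functions)
  have hecont : Continuous e := by
    have hon : ∀ X, ContinuousOn e (Iic X) := by
      intro X
      obtain ⟨B, hB0, hBle⟩ := hB 0 X
      have hunif : TendstoUniformlyOn (fun u x ↦ partialV ψ u x) e atBot (Iic X) := by
        rw [Metric.tendstoUniformlyOn_iff]
        intro ε hε
        have hev : ∀ᶠ u in atBot, efWeight M r v₁ u < ε / (B + 1) :=
          hP.eventually (gt_mem_nhds (by positivity))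
        filter_upwards [hev, eventually_le_atBot (0 : ℝ)] with u hu hu0 x hx
        rw [Real.dist_eq, abs_sub_comm]
        calc |partialV ψ u x - e x| ≤ B * efWeight M r v₁ u := hBle u hu0 x hx
          _ ≤ B * (ε / (B + 1)) := mul_le_mul_of_nonneg_left hu.le hB0
          _ < ε := by rw [mul_div_assoc', div_lt_iff₀ (by positivity)]; nlinarith
      exact hunif.continuousOn (Eventually.of_forall fun u ↦
        (h.isRadiationField.continuous_partialV_snd u).continuousOn).frequently
    exact continuous_iff_continuousAt.2 fun x ↦
      (hon (x + 1)).continuousAt (Iic_mem_nhds (by linarith))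
  -- `G(x) = ∫_{v₁}^{x} e`
  have hGint : ∀ x, G x = ∫ y in v₁..x, e y := by
    intro x
    obtain ⟨B, hB0, hBle⟩ := hB 0 (max v₁ x)
    have hlim : Tendsto (fun u ↦ ψ u x) atBot (𝓝 (∫ y in v₁..x, e y)) := by
      have hdiff : Tendsto (fun u ↦ ψ u x - ∫ y in v₁..x, e y) atBot (𝓝 0) := by
        refine squeeze_zero_norm' ?_ (by simpa using hP.const_mul (B * |x - v₁|))
        filter_upwards [eventually_le_atBot (0 : ℝ)] with u hu
        have hEc := h.isRadiationField.continuous_partialV_snd u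
        rw [h.isRadiationField.eq_integral_partialV (fun u v hv ↦ h.eq_zero hv) u x,
          ← intervalIntegral.integral_sub (hEc.intervalIntegrable _ _)
            (hecont.intervalIntegrable _ _), Real.norm_eq_abs]
        have key := intervalIntegral.norm_integral_le_of_norm_le_const (a := v₁) (b := x)
          (C := B * efWeight M r v₁ u) (f := fun y ↦ partialV ψ u y - e y) fun y hy ↦ ?_
        · simpa [mul_comm, mul_assoc, mul_left_comm] using key
        · rw [Real.norm_eq_abs]
          exact hBle u hu y (uIoc_subset_uIcc hy).2
      have := hdiff.add_const (∫ y in v₁..x, e y)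
      simpa using this
    exact tendsto_nhds_unique (h.tendsto_atBot x) hlim
  have hGderiv : ∀ x, HasDerivAt G (e x) x := by
    intro x
    have hG : G = fun x ↦ ∫ y in v₁..x, e y := funext hGint
    rw [hG]
    exact intervalIntegral.integral_hasDerivAt_right (hecont.intervalIntegrable _ _)
      (hecont.stronglyMeasurableAtFilter _ _) hecont.continuousAt
  have he_eq : ∀ x, e x = deriv G x := fun x ↦ (hGderiv x).deriv.symm
  refine ⟨fun x ↦ he_eq x ▸ hGderiv x, fun x ↦ he_eq x ▸ he x, fun U X ↦ ?_⟩
  obtain ⟨B, hB0, hBle⟩ := hB U X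
  exact ⟨B, hB0, fun u hu x hx ↦ he_eq x ▸ hBle u hu x hx⟩

/-- The data of a scattering solution are differentiable. [folklore] -/
theorem hasDerivAt_data (hM : 0 < M) (hr : IsEFAreaRadius M r)
    (h : IsScatteringSolution M r v₁ G ψ) (x : ℝ) : HasDerivAt G (deriv G x) x :=
  (h.tendsto_partialV_deriv hM hr).1 x

/-- **`∂ᵥψ` is the integral of `Vψ` from `𝓘⁻`, quantitatively**: if `|ψ(s, x)| ≤ m` for all
`s ≤ u`, then `|∂ᵥψ(u, x) − G'(x)| ≤ m · efWeight M r x u` (`= m ∫_{−∞}^{u} 2M/r(s, x)³ ds`;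
`≤ 4Mm/r(u, x)²` on `r ≥ 4M` by `efWeight_le_of_le`). [folklore] -/
theorem abs_partialV_sub_deriv_le (hM : 0 < M) (hr : IsEFAreaRadius M r)
    (h : IsScatteringSolution M r v₁ G ψ) {u x m : ℝ} (hm : ∀ s ≤ u, |ψ s x| ≤ m) :
    |partialV ψ u x - deriv G x| ≤ m * efWeight M r x u := by
  have key := abs_sub_lim_le_of_abs_deriv_le (U := u) (fun s _ ↦ h.hasDerivAt_partialV_fst s x)
    (fun s _ ↦ (hasDerivAt_efWeight (v₁ := x) hM hr s).const_mul m) (fun s hs ↦ ?_)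
    ((h.tendsto_partialV_deriv hM hr).2.1 x)
    ((tendsto_efWeight_atBot (v₁ := x) hM hr).const_mul m) le_rfl
  · simpa using key
  · rw [abs_mul, mul_comm m]
    exact mul_le_mul (abs_efPotential_le hM hr s x) (hm s hs.le) (abs_nonneg _)
      (efPotentialBound_nonneg hM hr s)

end IsScatteringSolution

/-! ### Derivatives along the diagonal `s ↦ (u + s, v + s)` -/

section Diag

variable {φ : ℝ → ℝ → ℝ}

/-- For jointly smooth `φ`, the derivative of `y ↦ φ(a + y, y)` is `(∂ᵤφ + ∂ᵥφ)(a + y, y)`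
(chain rule along the direction `(1, 1)`, the generator `T = ∂ᵤ + ∂ᵥ` of time translations).
[folklore] -/
theorem hasDerivAt_diag (hφ : ContDiff ℝ ((⊤ : ℕ∞) : WithTop ℕ∞) (Function.uncurry φ))
    (a y : ℝ) : HasDerivAt (fun y' ↦ φ (a + y') y')
      (partialU φ (a + y) y + partialV φ (a + y) y) y := by
  set F := Function.uncurry φ with hF
  have hF1 : DifferentiableAt ℝ F (a + y, y) := hφ.differentiable (by simp) _
  have hγ : HasDerivAt (fun y' : ℝ ↦ (a + y', y')) ((1 : ℝ), (1 : ℝ)) y :=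
    ((hasDerivAt_id y).const_add a).prodMk (hasDerivAt_id y)
  have h : HasDerivAt (F ∘ fun y' : ℝ ↦ (a + y', y')) (fderiv ℝ F (a + y, y) ((1 : ℝ), (1 : ℝ))) y :=
    hF1.hasFDerivAt.comp_hasDerivAt (f := fun y' : ℝ ↦ (a + y', y')) y hγ
  have heq : fderiv ℝ F (a + y, y) ((1 : ℝ), (1 : ℝ)) =
      partialU φ (a + y) y + partialV φ (a + y) y := by
    rw [partialU_eq_fderiv hφ, partialV_eq_fderiv hφ, ← map_add]
    simp [hF]
  rw [← heq]
  exact h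

/-- The same along `s ↦ (u + s, v + s)` at `s = 0`: the derivative is `(∂ᵤφ + ∂ᵥφ)(u, v)`.
[folklore] -/
theorem hasDerivAt_diag_zero (hφ : ContDiff ℝ ((⊤ : ℕ∞) : WithTop ℕ∞) (Function.uncurry φ))
    (u v : ℝ) : HasDerivAt (fun s ↦ φ (u + s) (v + s))
      (partialU φ u v + partialV φ u v) 0 := by
  have h := hasDerivAt_diag hφ (u - v) v
  simp only [sub_add_cancel] at h
  have h' : HasDerivAt (fun y' ↦ φ (u - v + y') y') (partialU φ u v + partialV φ u v) (v + 0) := by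
    rw [add_zero]; exact h
  have h2 : HasDerivAt (fun s ↦ φ (u - v + (v + s)) (v + s))
      (partialU φ u v + partialV φ u v) 0 :=
    HasDerivAt.comp_const_add (f := fun y' ↦ φ (u - v + y') y') v 0 h'
  refine h2.congr_of_eventuallyEq (Eventually.of_forall fun s ↦ ?_)
  simp only; congr 1; ring

end Diag

/-! ### The area radius and the potential are invariant under time translations -/

namespace IsEFAreaRadius

variable {M : ℝ} {r : ℝ → ℝ → ℝ}

/-- `r(u + s, v + s) = r(u, v)`: the area radius is a function of `v − u` alone (tortoise
identity `r + 2M log(r − 2M) = v − u + c` and strict monotonicity of `ρ ↦ ρ + 2M log(ρ − 2M)` on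
`ρ > 2M`; the time-translation invariance of Schwarzschild). [cite: Kehrberger2022AHP, §3.2] -/
theorem diag_invariant (hr : IsEFAreaRadius M r) (hM : 0 ≤ M) (u v s : ℝ) :
    r (u + s) (v + s) = r u v := by
  obtain ⟨c, hc⟩ := hr.exists_tortoise_const hM
  have h1 := hc (u + s) (v + s)
  have h2 := hc u v
  have heq : r (u + s) (v + s) + 2 * M * Real.log (r (u + s) (v + s) - 2 * M) =
      r u v + 2 * M * Real.log (r u v - 2 * M) := by rw [h1, h2]; ring
  -- strict monotonicity of the tortoise function
  have hmono : StrictMonoOn (fun ρ ↦ ρ + 2 * M * Real.log (ρ - 2 * M)) (Ioi (2 * M)) := by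
    intro a ha b hb hab
    have hlog : Real.log (a - 2 * M) ≤ Real.log (b - 2 * M) :=
      Real.log_le_log (by simp at ha; linarith) (by linarith)
    simp only
    nlinarith
  exact hmono.injOn (hr.1 _ _) (hr.1 _ _) heq

/-- `r(u − v + y, y) = r(u, v)` (the form used for the time integral). [folklore] -/
theorem diag_invariant' (hr : IsEFAreaRadius M r) (hM : 0 ≤ M) (u v y : ℝ) :
    r (u - v + y) y = r u v := by
  have := hr.diag_invariant hM u v (y - v)
  rw [show u + (y - v) = u - v + y by ring, show v + (y - v) = y by ring] at this
  exact this

end IsEFAreaRadius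

/-- The potential is invariant under time translations: `V(u − v + y, y) = V(u, v)`. [folklore] -/
theorem efPotential_diag {M : ℝ} {r : ℝ → ℝ → ℝ} (hr : IsEFAreaRadius M r) (hM : 0 ≤ M)
    (u v y : ℝ) : efPotential M r (u - v + y) y = efPotential M r u v := by
  simp only [efPotential, hr.diag_invariant' hM]

/-! ### The time integral of a function of `(u, v)` -/

/-- **The time integral** of a function `ψ` of the double null coordinates, relative to the
initial advanced time `v₁`: `ψ^T(u, v) := ∫_{v₁}^{v} ψ(u − v + y, y) dy`, the integral of `ψ`
along the time-translation orbit through `(u, v)` backwards until it meets `{v = v₁}`. For a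
scattering solution `ψ = rφ` with data `G` this is the solution `rφ^T` with data
`G^T(v) = ∫_{v₁}^{v} G` and `(∂ᵤ + ∂ᵥ)(rφ^T) = rφ` of the proof of Thm. 6.2 ("the time integral of
`rφ`", Kehrberger; there obtained from an existence theorem and uniqueness, here written down
explicitly). [cite: Kehrberger2022AHP, proof of Thm. 6.2, eqs. (6.22)–(6.23)] -/
def timeIntegral (v₁ : ℝ) (ψ : ℝ → ℝ → ℝ) (u v : ℝ) : ℝ := ∫ y in v₁..v, ψ (u - v + y) y

/-- Unfolding lemma. [folklore] -/
lemma timeIntegral_apply (v₁ : ℝ) (ψ : ℝ → ℝ → ℝ) (u v : ℝ) :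
    timeIntegral v₁ ψ u v = ∫ y in v₁..v, ψ (u - v + y) y := rfl

/-- Along the time-translation orbit the integrand is fixed and only the upper limit moves:
`ψ^T(u + s, v + s) = ∫_{v₁}^{v+s} ψ(u − v + y, y) dy`. [folklore] -/
lemma timeIntegral_diag (v₁ : ℝ) (ψ : ℝ → ℝ → ℝ) (u v s : ℝ) :
    timeIntegral v₁ ψ (u + s) (v + s) = ∫ y in v₁..(v + s), ψ (u - v + y) y := by
  rw [timeIntegral_apply]
  congr 1
  funext y
  congr 1
  ring

/-- The time integral as an integral over the unit interval (substitution `y = v₁ + t(v − v₁)`):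
`ψ^T(u, v) = (v − v₁) ∫₀¹ ψ(u − v + v₁ + t(v − v₁), v₁ + t(v − v₁)) dt`. [folklore] -/
lemma timeIntegral_eq_unit (v₁ : ℝ) (ψ : ℝ → ℝ → ℝ) (u v : ℝ) :
    timeIntegral v₁ ψ u v =
      (v - v₁) * ∫ t in (0 : ℝ)..1, ψ (u - v + ((v - v₁) * t + v₁)) ((v - v₁) * t + v₁) := by
  rw [timeIntegral_apply, ← smul_eq_mul,
    intervalIntegral.smul_integral_comp_mul_add (fun y ↦ ψ (u - v + y) y) (v - v₁) v₁]
  simp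

end Literature.Barriers.FinalStateConjecture

end
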